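import Summits.QuantumFields.BalabanUV.T4Continuum.Spine.NE1p.DressedRootStrict
import Summits.QuantumFields.BalabanUV.T4Continuum.Spine.NE1p.DressedRootSeparation

/-!
# T⁴ programme, spine estimate NE1′ (node O3b/H2) — THE FAMILY DOOR FIRES, AND ONLY IT: a decided tower with a GENUINE history
# weight on which ROOT-B holds THROUGH END-B-fam `DressedRootFam.dressedBudget_of_familyLeaves` while ROOT-C (the headline
# `DressedStability`, hence END-B's uniform bundle) FAILS — ROOT-B ⇏ ROOT-C at unit weights (the converse of the owner's
# `DressedRootStrict.dressedStability_not_imp_dressedBudget`), decided in kernel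

Cell `pub-balaban`, sub-cell `t4`, BINDER-OWNERS row NE1′ (owner lineage t4-ne1p-p1, skeleton `t4/skeletons/NE1p-t4-ne1p-p1.md`
§1 ROOT-B ∕ END-B-fam); crew `b2b-balaban-t4-ne1p-formalise-*`, unit `b2b-balaban-t4-ne1p-formalise-leaf-02` (gen 15); tree
target `Summits/QuantumFields/BalabanUV/T4Continuum/Spine/NE1p/`; ADDITIVE — imports `Spine/NE1p/DressedRootStrict` (owner g23,
p216910 → `DressedRootFam` p211697: `DressedBudget`, `BookingLeavesFam`, `dressedBudget_of_familyLeaves`) and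
`Spine/NE1p/DressedRootSeparation` (W4, p213760: `births_bounded_of_dressedStability`) ONLY; theorems + decided toy DATA; nothing of
the imported modules is restated — used BY NAME.

WHY THIS FILE.  The row's budget root ROOT-B `DressedRootFam.DressedBudget 𝒯 w` has TWO ENDs in the tree: the CLASS door
(`dressedBudget_of_dressedStabilityWith_strict` ∕ `DressedRootStrict.dressedBudget_of_dressedStabilityStrict`: ROOT-C + K-free counts +
the strict product) and the FAMILY door END-B-fam `dressedBudget_of_familyLeaves` over the family-format bundle `BookingLeavesFam U`
(family birth constants, HISTORY WEIGHTS `H b`, family classes `σ b k ≤ H b ×` the uniform class, the history-WEIGHTED positional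
counts `hcountH` ∕ `hcountHq`).  Every decided witness of the crew so far (W1–W53) enters through `BookingLeaves U` (= the case
`H ≡ 1`, `BookingLeaves.toFam`) or through the (γ) composition faces; END-B-fam and `BookingLeavesFam` with a non-constant weight had
NO applier.  This file decides, on a two-family toy, that the family door is STRICTLY WIDER than the class door:
* `famBooking K` ∕ `famTrajectory K` ∕ `famTower` [decided toy DATA]: per cutoff `K` two observable-attached families born at scale
  `0` — the SPINE (history weight `1`, per-step rate `1∕8`, felt at one cube of every scale) and the HEAVY family (history weight
  `3^K`, per-step rate `1∕4`, felt at the top cube only); booked sizes `H b·(rate b)^k·(1∕2)^K`, one generation (the birth).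
* `famConstants` [decided]: ONE `U` (`C = 1`, `A₀ = 1`, `ρ₁ = 1∕4`, `τ = 1∕2`, `Λ = 3`, `N₀ = 2`, `ρ′ = 3∕8 = Λρ₁τ`, `s̄⁰ = 1∕2`,
  `m = 1∕8`) and `famLeaves K : BookingLeavesFam famConstants (famBooking K) (famTrajectory K)` AT EVERY CUTOFF with the GENUINE
  weight `H heavy = 3^K` (`famH_heavy`, `famH_unbounded`: no K-free cap per family exists — door 2's «K-free cap» reading fails
  here), FAMILY-dependent rates (`1∕8` ≠ `1∕4`), door-2 classes `σ b k = H b·(A₀ρ₁^k τ^K)` EXACTLY, and the weighted count of the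
  top component `1 + 3^K ≤ N₀Λ^K = 2·3^K` carried by the positional room `Λ^K` (`weightedCount_top`; the plain count there is `2`).
* `dressedBudget_famTower` — ROOT-B `DressedBudget famTower w` for EVERY weight profile `0 ≤ w ≤ w̄` THROUGH END-B-fam
  `dressedBudget_of_familyLeaves` (FIRST APPLIER; cube-side weighted count `hcountHq_fam`), `c_B = w̄·N₀A₀∕(1−ρ′) = w̄·16∕5`.
* `not_dressedStability_famTower` — ROOT-C FAILS: the heavy birth size `(3∕2)^K` is unbounded in the cutoff
  (`births_bounded_of_dressedStability` BY NAME + `pow_unbounded_of_one_lt`); hence `not_dressedStabilityStrict_famTower` (ROOT-C of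
  record fails at every rate `Λ`) and `no_uniformLeaves_famTower`: END-B's bundle `BookingLeaves U` is EMPTY at some cutoff for EVERY
  `U` — on this tower the family door is the ONLY door.
* `familyDoor_strictly_wider : DressedBudget famTower 1 ∧ ¬ DressedStability famTower` and
  `dressedBudget_not_imp_dressedStability` — the converse separation to the owner's `dressedStability_not_imp_dressedBudget`
  (`DressedRootStrict` l.167): ROOT-B and the headline ROOT-C are INCOMPARABLE on dressed towers, both directions now decided.

HONEST FRAMING.  A decided toy over the booking vocabulary; [folklore] bookkeeping, 0 sorry, 0 citations, NO `def … : Prop` minted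
(the toy DATA defs are `Booking`∕`Trajectory`∕`DressedTower`∕`UniformConstants`∕`BookingLeavesFam` terms and two numeral profiles).
NOTHING of Bałaban's densities is modelled or asserted.  This file shows the family door ADMITS bookings no uniform class admits; it
does NOT say which door the cell takes for the history price (`t4/ideate/NE1p-WALL.md` §5 — the owner's ∕ the wall's); pays no history
price on Bałaban's densities; discharges no wall item; wall v1.7 (T4-DAG v46) does NOT move; R-t4r2-Q2 NOT met thereby.  Headline
(c4): «END-B-fam ⇐ its named binders is inhabited where END-B is not», NEVER «NE1′ proved»; NE1′ NOT PRINTED, NOT PROVED; 0 binders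
instantiated on Bałaban's densities; the wall (w1) ∕ (w2-act) ∕ (w5) ∕ (I4′) stands DISPLAYED; spine PROVED 0∕9 unchanged; count 9
unchanged.  Rung (B)+1 on ONE finite four-torus — NOT infinite volume, NOT a mass gap, NOT OS on ℝ⁴, NOT Clay, NOT summit progress.
Crew row W56 ∕ DAG N29zzzb of `t4/formal/NE1p/LEAVES.md`, BOOKED by typer RULING R-T130 (CLAIMS.log l.20558) on INTENT l.20486.
HONEST DEPENDENCY: continuum YM on T⁴ ⇐ BetaPertH ∧ nine spine estimates (0/9 proved); BetaPertH ⇐ (D1) ∧ (D4) ∧ CAP+tail; G-an2-4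
gates asym, D1 and NE2/3/4.
-/

noncomputable section

namespace Summit.QuantumFields.BalabanUV.T4Continuum.NE1p.DressedFamilyDoorWitness

open Finset
open scoped BigOperators
open Literature.MathematicalPhysics.QuantumFieldTheory.Balaban1983to89
open Literature.MathematicalPhysics.QuantumFieldTheory.Balaban1983to89.T4TermFormat
open Literature.MathematicalPhysics.QuantumFieldTheory.Balaban1983to89.T4TermFormat.Booking
open Literature.MathematicalPhysics.QuantumFieldTheory.Balaban1983to89.T4GatedBooking
open Literature.MathematicalPhysics.QuantumFieldTheory.Balaban1983to89.T4TrajectoryComparison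
open Summit.QuantumFields.BalabanUV.T4Continuum.T4TrajectoryDensityDressed
open Summit.QuantumFields.BalabanUV.T4Continuum.NE1pFamilyBudget
open Summit.QuantumFields.BalabanUV.T4Continuum.NE1p.DressedRoot
open Summit.QuantumFields.BalabanUV.T4Continuum.NE1p.DressedRootSeparation

/-! ## §1 The two-family toy: a spine and a heavy family per cutoff -/

/-- HISTORY WEIGHT PROFILE at cutoff `K` [decided toy DATA]: the spine (`false`) weighs `1`, the heavy family (`true`) weighs `3^K`
— GENUINELY cutoff-dependent, no K-free cap (`famH_unbounded`). [folklore] -/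
def famH (K : ℕ) : Bool → ℝ := fun b => if b then (3 : ℝ) ^ K else 1

/-- PER-STEP RATE PROFILE [decided toy DATA]: the spine contracts by `1∕8` per step, the heavy family by `1∕4` — FAMILY-dependent
rates, both within the uniform `ρ₁ = 1∕4`. [folklore] -/
def famRate : Bool → ℝ := fun b => if b then 1 / 4 else 1 / 8

/-- The weights are positive. [folklore] -/
theorem famH_pos (K : ℕ) (b : Bool) : 0 < famH K b := by
  unfold famH; split_ifs <;> positivity

/-- Read-out: the spine weighs `1`. [folklore] -/
@[simp] theorem famH_spine (K : ℕ) : famH K false = 1 := by simp [famH]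

/-- Read-out: the heavy family weighs `3^K`. [folklore] -/
@[simp] theorem famH_heavy (K : ℕ) : famH K true = (3 : ℝ) ^ K := by simp [famH]

/-- The rates are nonnegative. [folklore] -/
theorem famRate_nonneg (b : Bool) : 0 ≤ famRate b := by
  unfold famRate; split_ifs <;> norm_num

/-- The rates are within the uniform `ρ₁ = 1∕4`. [folklore] -/
theorem famRate_le (b : Bool) : famRate b ≤ 1 / 4 := by
  unfold famRate; split_ifs <;> norm_num

/-- **NO K-FREE CAP PER FAMILY** [decided]: the heavy weight `3^K` exceeds every constant at some cutoff. [folklore] -/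
theorem famH_unbounded (c : ℝ) : ∃ K : ℕ, c < famH K true := by
  obtain ⟨K, hK⟩ := pow_unbounded_of_one_lt c (by norm_num : (1 : ℝ) < 3)
  exact ⟨K, by simpa using hK⟩

/-- THE TWO-FAMILY BOOKING at cutoff `K` [decided toy DATA]: families `Bool` (`false` = spine, `true` = heavy), both born at scale
`0`; one cube per scale `Fin (K+1)`; the top cube feels BOTH families, every lower cube feels the spine only; booked size of `b`
at scale `k` = `H b·(rate b)^k·(1∕2)^K`.  Nothing of Bałaban's is modelled. [folklore] -/
def famBooking (K : ℕ) : T4TermFormat.Booking where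
  K := K
  Dom := Unit
  domScale := fun _ => 0
  treeLen := fun _ => 0
  treeLen_nonneg := fun _ => le_rfl
  balSize := fun _ => 0
  Birth := Bool
  births := Finset.univ
  mem_births := fun b => Finset.mem_univ b
  birthScale := fun _ => 0
  birth_le := fun _ => Nat.zero_le K
  loc := fun _ => ()
  loc_scale := fun _ => rfl
  Cube := Fin (K + 1)
  cubes := Finset.univ
  mem_cubes := fun q => Finset.mem_univ q
  cubeScale := fun q => q.val
  cube_le := fun q => Nat.lt_succ_iff.mp q.isLt
  feltAt := fun q => if q.val = K then Finset.univ else {false}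
  felt_birth_le := fun _ _ _ => Nat.zero_le _
  size := fun b k => famH K b * famRate b ^ k * (1 / 2 : ℝ) ^ K
  size_nonneg := fun b k => mul_nonneg (mul_nonneg (famH_pos K b).le (pow_nonneg (famRate_nonneg b) k)) (by positivity)
  pair := fun _ _ _ => 0

/-- Field read-out: every family is born at scale `0`. [folklore] -/
@[simp] theorem famBooking_birthScale (K : ℕ) (b : (famBooking K).Birth) : (famBooking K).birthScale b = 0 := rfl

/-- Field read-out: the booked size. [folklore] -/
theorem famBooking_size (K : ℕ) (b : Bool) (k : ℕ) :
    (famBooking K).size b k = famH K b * famRate b ^ k * (1 / 2 : ℝ) ^ K := rfl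

/-- THE TWO-FAMILY TRAJECTORY [decided toy DATA]: one generation per family (the birth, size `H b·(1∕2)^K`), re-linearised size of
generation `0` at scale `k` = the booked size. [folklore] -/
def famTrajectory (K : ℕ) : Trajectory (famBooking K) where
  lin := fun b k' k => if k' = 0 then famH K b * famRate b ^ k * (1 / 2 : ℝ) ^ K else 0
  lin_nonneg := fun b k' k => by
    split_ifs
    · exact mul_nonneg (mul_nonneg (famH_pos K b).le (pow_nonneg (famRate_nonneg b) k)) (by positivity)
    · exact le_rfl
  gen := fun b k' => if k' = 0 then famH K b * (1 / 2 : ℝ) ^ K else 0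
  gen_nonneg := fun b k' => by
    split_ifs
    · exact mul_nonneg (famH_pos K b).le (by positivity)
    · exact le_rfl
  size_le := fun b k _ _ => by
    show famH K b * famRate b ^ k * (1 / 2 : ℝ) ^ K ≤
      ∑ k' ∈ Icc 0 k, (if k' = 0 then famH K b * famRate b ^ k * (1 / 2 : ℝ) ^ K else 0)
    rw [Finset.sum_ite_eq' (Icc 0 k) 0 (fun _ => famH K b * famRate b ^ k * (1 / 2 : ℝ) ^ K)]
    simp

/-- THE TWO-FAMILY TOWER [decided toy DATA]: the two-family booking and trajectory at every cutoff (one run parameter). [folklore] -/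
def famTower : DressedTower Unit where
  B := fun _ K => famBooking K
  K_eq := fun _ _ => rfl
  T := fun _ K => famTrajectory K

/-- THE UNIFORM CONSTANTS of the family door [decided]: `C = 1`, `A₀ = 1`, `ρ₁ = 1∕4`, `τ = 1∕2`, `Λ = 3`, `N₀ = 2`, `ρ′ = 3∕8`
(`Λρ₁τ = 3∕8` EXACTLY), `s̄⁰ = 1∕2`, `m = 1∕8` (`m·N₀A₀(1−ρ′)⁻¹ = 2∕5 ≤ 1∕2 = 1 − s̄⁰`). [folklore] -/
def famConstants : UniformConstants where
  C := 1
  A₀ := 1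
  ρ₁ := 1 / 4
  τ := 1 / 2
  Λ := 3
  N₀ := 2
  ρ' := 3 / 8
  sbar := 1 / 2
  m := 1 / 8
  hC := zero_le_one
  hA₀ := zero_le_one
  hρ₁ := by norm_num
  hτ0 := by norm_num
  hτ1 := by norm_num
  hΛ := by norm_num
  hN₀ := by norm_num
  hm := by norm_num
  hρ'1 := by norm_num
  hprod := by norm_num
  hsmall := by norm_num

/-- THE LIVE FAMILIES of the met component at step `k` [decided toy DATA]: both families at the top step `k = K`, the spine alone
below (= the families felt at the cube of that scale). [folklore] -/
def famS (K : ℕ) : ℕ → Bool → Finset Bool := fun k _ => if k = K then Finset.univ else {false}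

/-! ## §2 The weighted counts: the heavy weight `3^K` is carried by the positional room `Λ^K` -/

/-- **THE WEIGHTED COUNT OF THE TOP COMPONENT** [decided]: `1 + 3^K ≤ N₀Λ^K = 2·3^K` — the heavy weight is absorbed by the
positional room `Λ^K` of a family born `K` scales below the cube (the PLAIN count there is `2`). [folklore] -/
theorem weightedCount_top (K : ℕ) : 1 + (3 : ℝ) ^ K ≤ 2 * (3 : ℝ) ^ K := by
  have : (1 : ℝ) ≤ 3 ^ K := one_le_pow₀ (by norm_num)
  linarith

/-- The weighted sum over a live-family finset: `1 + 3^K` at the top step, `1` below. [folklore] -/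
theorem sum_famS (K k : ℕ) (b : Bool) :
    ∑ f ∈ famS K k b, famH K f = if k = K then 1 + (3 : ℝ) ^ K else 1 := by
  unfold famS
  split_ifs
  · rw [Fintype.sum_bool, famH_heavy, famH_spine, add_comm]
  · rw [Finset.sum_singleton, famH_spine]

/-- The weighted sum over a live-family finset at step `k` is `≤ N₀Λ^k = 2·3^k`. [folklore] -/
theorem sum_famS_le (K k : ℕ) (b : Bool) : ∑ f ∈ famS K k b, famH K f ≤ 2 * (3 : ℝ) ^ k := by
  rw [sum_famS]
  split_ifs with hk
  · rw [hk]; exact weightedCount_top K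
  · have : (1 : ℝ) ≤ 3 ^ k := one_le_pow₀ (by norm_num)
    linarith

/-- The weighted count of any `famS` component at any step, per birth scale: `Σ_{f ∈ S k b, j_f = j} H f ≤ N₀Λ^{k−j}` with
`N₀ = 2`, `Λ = 3` (the `BookingLeavesFam.hcountH` field; the scale-`0` fibre is the whole finset, the others are empty).
[folklore] -/
theorem hcountH_fam (K : ℕ) : ∀ k (b : Bool), ∀ j ≤ k,
    ∑ f ∈ (famS K k b).filter (fun f => (famBooking K).birthScale f = j), famH K f ≤ 2 * (3 : ℝ) ^ (k - j) := by
  intro k b j _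
  by_cases hj : j = 0
  · subst hj
    rw [Nat.sub_zero]
    exact (Finset.sum_le_sum_of_subset_of_nonneg (Finset.filter_subset _ _) fun f _ _ => (famH_pos K f).le).trans
      (sum_famS_le K k b)
  · rw [Finset.sum_eq_zero fun f hf => (hj ((Finset.mem_filter.mp hf).2).symm).elim]
    positivity

/-- The weighted sum over the families felt at a cube: `1 + 3^K` at the top cube, `1` below. [folklore] -/
theorem sum_feltAt (K : ℕ) (q : Fin (K + 1)) :
    ∑ b ∈ (famBooking K).feltAt q, famH K b = if q.val = K then 1 + (3 : ℝ) ^ K else 1 := by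
  show ∑ b ∈ (if q.val = K then (Finset.univ : Finset Bool) else {false}), famH K b = _
  split_ifs
  · rw [Fintype.sum_bool, famH_heavy, famH_spine, add_comm]
  · rw [Finset.sum_singleton, famH_spine]

/-- The weighted sum over the families felt at a cube of scale `k` is `≤ N₀Λ^k = 2·3^k`. [folklore] -/
theorem sum_feltAt_le (K : ℕ) (q : Fin (K + 1)) : ∑ b ∈ (famBooking K).feltAt q, famH K b ≤ 2 * (3 : ℝ) ^ q.val := by
  rw [sum_feltAt]
  split_ifs with hq
  · rw [hq]; exact weightedCount_top K
  · have : (1 : ℝ) ≤ 3 ^ q.val := one_le_pow₀ (by norm_num)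
    linarith

/-- The CUBE-SIDE weighted count (the `hcountHq` binder of END-B-fam): at every cube `q` and birth scale `j ≤ k_q`,
`Σ_{b felt at q, j_b = j} H b ≤ N₀Λ^{k_q − j}`. [folklore] -/
theorem hcountHq_fam (K : ℕ) : ∀ (q : (famBooking K).Cube) (j : ℕ), j ≤ (famBooking K).cubeScale q →
    ∑ b ∈ (famBooking K).feltOfScale q j, famH K b ≤
      famConstants.N₀ * famConstants.Λ ^ ((famBooking K).cubeScale q - j) := by
  intro q j _
  show ∑ b ∈ ((famBooking K).feltAt q).filter (fun b => (famBooking K).birthScale b = j), famH K b ≤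
    2 * (3 : ℝ) ^ (q.val - j)
  by_cases hj : j = 0
  · subst hj
    rw [Nat.sub_zero]
    exact (Finset.sum_le_sum_of_subset_of_nonneg (Finset.filter_subset _ _) fun f _ _ => (famH_pos K f).le).trans
      (sum_feltAt_le K q)
  · rw [Finset.sum_eq_zero fun f hf => (hj ((Finset.mem_filter.mp hf).2).symm).elim]
    positivity

/-! ## §3 The family-format leaf bundle at every cutoff, with ONE set of constants -/

/-- **THE FAMILY LEAVES** [decided]: at every cutoff the family-format binders hold with `famConstants` — family birth constants
`C ≡ 1`, the GENUINE history weights `famH K` (`3^K` on the heavy family), family rates `famRate` (`1∕8`, `1∕4`), no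
regeneration, door-2 classes `σ b k = H b·(A₀ρ₁^k τ^K)` EXACTLY, action margins `0`, live families `famS`; births, transport and
regeneration hold outright (a fortiori under the family-dressed gate), the weighted count by `hcountH_fam`. [folklore] -/
def famLeaves (K : ℕ) : BookingLeavesFam famConstants (famBooking K) (famTrajectory K) where
  C := fun _ => 1
  H := famH K
  ρ := fun b _ => famRate b
  c := fun _ _ => 0
  σ := fun b k => famH K b * ((1 : ℝ) * (1 / 4 : ℝ) ^ k * (1 / 2 : ℝ) ^ K)
  s₀ := fun _ _ => 0
  S := famS K
  hC := fun _ => zero_le_one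
  hρ := fun b _ => famRate_nonneg b
  hc := fun _ _ => le_rfl
  hrate := fun b k _ _ => by
    show (famRate b + 1 * 0) * (famH K b * (1 * (1 / 4 : ℝ) ^ k * (1 / 2 : ℝ) ^ K)) ≤
      famH K b * (1 * (1 / 4 : ℝ) ^ (k + 1) * (1 / 2 : ℝ) ^ K)
    have hX : 0 ≤ famH K b * (1 * (1 / 4 : ℝ) ^ k * (1 / 2 : ℝ) ^ K) :=
      mul_nonneg (famH_pos K b).le (by positivity)
    calc (famRate b + 1 * 0) * (famH K b * (1 * (1 / 4 : ℝ) ^ k * (1 / 2 : ℝ) ^ K))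
        = famRate b * (famH K b * (1 * (1 / 4 : ℝ) ^ k * (1 / 2 : ℝ) ^ K)) := by ring
      _ ≤ (1 / 4 : ℝ) * (famH K b * (1 * (1 / 4 : ℝ) ^ k * (1 / 2 : ℝ) ^ K)) :=
          mul_le_mul_of_nonneg_right (famRate_le b) hX
      _ = famH K b * (1 * (1 / 4 : ℝ) ^ (k + 1) * (1 / 2 : ℝ) ^ K) := by ring
  hσ := fun f k _ _ => by
    show famH K f * (1 * (1 / 4 : ℝ) ^ k * (1 / 2 : ℝ) ^ K) ≤
      famH K f * (famConstants.A₀ * famConstants.ρ₁ ^ (k - 0) * famConstants.τ ^ (K - 0))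
    exact le_of_eq rfl
  hS := fun k b f _ => Nat.zero_le k
  hcountH := hcountH_fam K
  hs₀ := fun _ _ => by
    show (0 : ℝ) ≤ 1 / 2
    norm_num
  hbirth := fun b _ _ _ => by
    show (1 : ℝ) * (if (0 : ℕ) = 0 then famH K b * (1 / 2 : ℝ) ^ K else 0) ≤
      famH K b * (1 * (1 / 4 : ℝ) ^ (0 : ℕ) * (1 / 2 : ℝ) ^ K)
    simp
  htr := fun b k' k _ _ _ _ => by
    show (if k' = 0 then famH K b * famRate b ^ k * (1 / 2 : ℝ) ^ K else 0) ≤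
      1 * stepProd (fun _ => famRate b) k' k * (if k' = 0 then famH K b * (1 / 2 : ℝ) ^ K else 0)
    by_cases h : k' = 0
    · subst h
      rw [if_pos rfl, if_pos rfl, stepProd_const, Nat.sub_zero]
      exact le_of_eq (by ring)
    · simp [h]
  hreg := fun b k _ _ _ => by
    show (if k + 1 = 0 then famH K b * (1 / 2 : ℝ) ^ K else 0) ≤ 0 * ((famBooking K).size b k)
    simp

/-! ## §4 ROOT-B through the family door, with one set of constants -/

/-- **ROOT-B THROUGH END-B-fam** [decided]: for every weight profile `0 ≤ w ≤ w̄` the two-family tower has the dressed budget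
`DressedBudget famTower w` — obtained from `DressedRootFam.dressedBudget_of_familyLeaves` with ONE `UniformConstants` serving every
cutoff and the cube-side weighted count `hcountHq_fam` (END-B-fam exercised end to end on a bundle with a NON-constant history
weight; `c_B = w̄·N₀A₀∕(1−ρ′) = w̄·16∕5`). [folklore] -/
theorem dressedBudget_famTower {w : Unit → ℕ → ℕ → ℝ} {wbar : ℝ} (hwbar : 0 ≤ wbar)
    (hw0 : ∀ p K, ∀ j ≤ K, 0 ≤ w p K j) (hwb : ∀ p K, ∀ j ≤ K, w p K j ≤ wbar) : DressedBudget famTower w :=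
  dressedBudget_of_familyLeaves famConstants famTower (fun _ K => famLeaves K) hwbar hw0 hwb fun _ K => hcountHq_fam K

/-- **ROOT-B AT UNIT WEIGHTS** [decided]: `DressedBudget famTower 1`. [folklore] -/
theorem dressedBudget_famTower_one : DressedBudget famTower (fun _ _ _ => (1 : ℝ)) :=
  dressedBudget_famTower zero_le_one (fun _ _ _ _ => zero_le_one) (fun _ _ _ _ => le_rfl)

/-! ## §5 ROOT-C fails: the heavy births are unbounded in the cutoff -/

/-- The heavy family's booked size at its birth scale is `(3∕2)^K`. [folklore] -/
theorem heavy_birth_size (K : ℕ) : (famBooking K).size true 0 = (3 / 2 : ℝ) ^ K := by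
  rw [famBooking_size, famH_heavy, pow_zero, mul_one, ← mul_pow]
  norm_num

/-- **THE HEADLINE ROOT-C FAILS** [decided]: `¬ DressedStability famTower` — a uniform `A₀` would bound the heavy birth size
`(3∕2)^K` at every cutoff (`DressedRootSeparation.births_bounded_of_dressedStability` BY NAME), impossible
(`pow_unbounded_of_one_lt`). [folklore] -/
theorem not_dressedStability_famTower : ¬ DressedStability famTower := by
  intro h
  obtain ⟨A₀, hA⟩ := births_bounded_of_dressedStability h
  obtain ⟨K, hK⟩ := pow_unbounded_of_one_lt A₀ (by norm_num : (1 : ℝ) < 3 / 2)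
  have h1 : (famBooking K).size true 0 ≤ A₀ := hA () K true
  rw [heavy_birth_size] at h1
  linarith

/-- **ROOT-C OF RECORD FAILS AT EVERY RATE** [decided]: `¬ DressedStabilityStrict famTower Λ` for every `Λ`
(`DressedRootStrict.dressedStability_of_strict` BY NAME). [folklore] -/
theorem not_dressedStabilityStrict_famTower (Λ : ℝ) : ¬ DressedStabilityStrict famTower Λ :=
  fun h => not_dressedStability_famTower (dressedStability_of_strict h)

/-- **END-B's UNIFORM BUNDLE IS UNINHABITABLE ON THIS TOWER** [decided]: there is no `U : UniformConstants` whose uniform leaf bundle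
`BookingLeaves U` is inhabited at every cutoff — else END-B `dressedStability_of_bookingLeaves` would give ROOT-C.  On this tower the
family door is the ONLY door to ROOT-B. [folklore] -/
theorem no_uniformLeaves_famTower :
    ¬ ∃ U : UniformConstants, ∀ K : ℕ, Nonempty (BookingLeaves U (famBooking K) (famTrajectory K)) := by
  rintro ⟨U, hU⟩
  exact not_dressedStability_famTower (dressedStability_of_bookingLeaves U famTower fun _ K => (hU K).some)

/-- … whereas the FAMILY bundle IS inhabited at every cutoff with ONE `U` (`famLeaves`). [folklore] -/
theorem familyLeaves_inhabited :
    ∃ U : UniformConstants, ∀ K : ℕ, Nonempty (BookingLeavesFam U (famBooking K) (famTrajectory K)) :=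
  ⟨famConstants, fun K => ⟨famLeaves K⟩⟩

/-! ## §6 The separation: ROOT-B does not imply ROOT-C -/

/-- **THE FAMILY DOOR IS STRICTLY WIDER** [decided]: the two-family tower has ROOT-B at unit weights (through END-B-fam) and NOT the
headline ROOT-C. [folklore] -/
theorem familyDoor_strictly_wider : DressedBudget famTower (fun _ _ _ => (1 : ℝ)) ∧ ¬ DressedStability famTower :=
  ⟨dressedBudget_famTower_one, not_dressedStability_famTower⟩

/-- **ROOT-B ⇏ ROOT-C** [decided]: the dressed budget at unit weights does not imply `DressedStability` on dressed towers — the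
converse of the owner's `DressedRootStrict.dressedStability_not_imp_dressedBudget`; together: the class root and the budget root
are INCOMPARABLE. [folklore] -/
theorem dressedBudget_not_imp_dressedStability :
    ¬ (∀ (𝒯 : DressedTower Unit), DressedBudget 𝒯 (fun _ _ _ => (1 : ℝ)) → DressedStability 𝒯) :=
  fun h => not_dressedStability_famTower (h famTower dressedBudget_famTower_one)

/-- Both separations side by side (owner's direction BY NAME). [folklore] -/
theorem roots_incomparable :
    ¬ (∀ (𝒯 : DressedTower Unit), DressedStability 𝒯 → DressedBudget 𝒯 (fun _ _ _ => (1 : ℝ))) ∧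
      ¬ (∀ (𝒯 : DressedTower Unit), DressedBudget 𝒯 (fun _ _ _ => (1 : ℝ)) → DressedStability 𝒯) :=
  ⟨dressedStability_not_imp_dressedBudget, dressedBudget_not_imp_dressedStability⟩

/-- Non-degeneracy: every booked size is positive at every cutoff and scale. [folklore] -/
theorem fam_size_pos (K k : ℕ) (b : Bool) : 0 < (famBooking K).size b k := by
  rw [famBooking_size]
  have h1 := famH_pos K b
  have h2 : 0 < famRate b := by unfold famRate; split_ifs <;> norm_num
  exact mul_pos (mul_pos h1 (pow_pos h2 k)) (by positivity)

end Summit.QuantumFields.BalabanUV.T4Continuum.NE1p.DressedFamilyDoorWitness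

end
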